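import Literature.MathematicalPhysics.QuantumLattice.GrassmannReflectionPositivity
import Literature.MathematicalPhysics.QuantumLattice.GrassmannEffectiveAction
import Mathlib.MeasureTheory.Constructions.BorelSpace.Complex
import HarnessLib

/-!
# Coefficientwise measurability and boundedness of Grassmann-valued random variables

For a map `X : Ω → Λ(ι)` from a measurable space into a (finite-dimensional, complex) Grassmann
algebra, `CoeffRegular X` says that every coefficient `ω ↦ [θ_s] X(ω)` in the monomial basis
`grassmannBasis` is measurable and bounded.  This is the regularity carried by the coefficients of
a lattice observable `U ↦ F(U)` (`QCDLatticeObservable.measurable/bounded`, stated through the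
Berezin pairing) and needed of the coefficient functions `g_I(U)` fed to the reflection-positivity
mechanism (`LatticeSiteRPKernelMechanism`).  The class is closed under the algebra operations —
sums, scalar functions, PRODUCTS (`CoeffRegular.mul`: `[θ_s](xy) = Σ_{t,t'} [θ_t]x [θ_{t'}]y [θ_s](θ_tθ_{t'})`),
list products, powers, fixed linear maps between Grassmann algebras, antilinear reflections
(`GrassmannAlgebra.Reflection`), the exponential of elements without constant term
(`grassmannExp = Σ_{k ≤ |ι|} xᵏ/k!`) — and every fixed linear functional of a regular `X` is a bounded
measurable scalar function (`CoeffRegular.measurable_apply`, `CoeffRegular.norm_apply_le`).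

References: F. A. Berezin, *The Method of Second Quantization* (1966), Ch. I §3 (coefficient
calculus); K. Osterwalder, E. Seiler, Ann. Phys. 110 (1978) 440, §2. Everything here is proved; no
named fact. [folklore]
-/

namespace Literature.MathematicalPhysics.QuantumLattice

open GrassmannAlgebra MeasureTheory
open scoped ComplexConjugate

noncomputable section

namespace GrassmannAlgebra

variable {Ω : Type*} [MeasurableSpace Ω] {ι : Type*} [LinearOrder ι] [Fintype ι]

/-- The coefficient of the monomial `θ_s`. [folklore] -/
abbrev coordFn (s : Finset ι) (x : GrassmannAlgebra ℂ ι) : ℂ := (grassmannBasis ℂ ι).repr x s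

omit [MeasurableSpace Ω] in
/-- Expansion in the monomial basis. [folklore] -/
theorem sum_coordFn_smul (x : GrassmannAlgebra ℂ ι) : ∑ s, coordFn s x • grassmannBasis ℂ ι s = x :=
  (grassmannBasis ℂ ι).sum_repr x

/-- **Coefficientwise regularity**: every monomial coefficient of `X` is measurable and bounded. [folklore] -/
def CoeffRegular (X : Ω → GrassmannAlgebra ℂ ι) : Prop :=
  ∀ s : Finset ι, Measurable (fun ω => coordFn s (X ω)) ∧ ∃ C : ℝ, ∀ ω, ‖coordFn s (X ω)‖ ≤ C

/-- Constants are regular. [folklore] -/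
theorem coeffRegular_const (x : GrassmannAlgebra ℂ ι) : CoeffRegular (fun _ : Ω => x) :=
  fun s => ⟨measurable_const, ‖coordFn s x‖, fun _ => le_rfl⟩

namespace CoeffRegular

variable {X Y : Ω → GrassmannAlgebra ℂ ι}

/-- Precomposition with a measurable map. [folklore] -/
theorem comp {Ω' : Type*} [MeasurableSpace Ω'] (hX : CoeffRegular X) {f : Ω' → Ω} (hf : Measurable f) :
    CoeffRegular (X ∘ f) := fun s =>
  ⟨(hX s).1.comp hf, by obtain ⟨C, hC⟩ := (hX s).2; exact ⟨C, fun ω => hC _⟩⟩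

/-- Sums are regular. [folklore] -/
theorem add (hX : CoeffRegular X) (hY : CoeffRegular Y) : CoeffRegular (fun ω => X ω + Y ω) := fun s => by
  obtain ⟨hm, C, hC⟩ := hX s
  obtain ⟨hm', C', hC'⟩ := hY s
  refine ⟨?_, C + C', fun ω => ?_⟩
  · simp only [coordFn, map_add, Finsupp.add_apply]
    exact hm.add hm'
  · simp only [coordFn, map_add, Finsupp.add_apply]
    exact (norm_add_le _ _).trans (add_le_add (hC ω) (hC' ω))

/-- Finite sums are regular. [folklore] -/
theorem sum {K : Type*} (s : Finset K) {X : K → Ω → GrassmannAlgebra ℂ ι} (hX : ∀ k ∈ s, CoeffRegular (X k)) :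
    CoeffRegular (fun ω => ∑ k ∈ s, X k ω) := by
  classical
  induction s using Finset.induction_on with
  | empty => simpa using coeffRegular_const (Ω := Ω) (0 : GrassmannAlgebra ℂ ι)
  | insert a s ha ih =>
    have h := (hX a (Finset.mem_insert_self a s)).add (ih fun k hk => hX k (Finset.mem_insert_of_mem hk))
    simpa [Finset.sum_insert ha] using h

/-- Multiplication by a bounded measurable scalar function. [folklore] -/
theorem smul (hX : CoeffRegular X) {f : Ω → ℂ} (hf : Measurable f) {Cf : ℝ} (hfb : ∀ ω, ‖f ω‖ ≤ Cf) :
    CoeffRegular (fun ω => f ω • X ω) := fun s => by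
  obtain ⟨hm, C, hC⟩ := hX s
  refine ⟨?_, |Cf| * C, fun ω => ?_⟩
  · simp only [coordFn, map_smul, Finsupp.smul_apply, smul_eq_mul]
    exact hf.mul hm
  · simp only [coordFn, map_smul, Finsupp.smul_apply, smul_eq_mul, norm_mul]
    exact mul_le_mul ((hfb ω).trans (le_abs_self _)) (hC ω) (norm_nonneg _) (abs_nonneg _)

/-- Constant scalar multiples. [folklore] -/
theorem const_smul (hX : CoeffRegular X) (c : ℂ) : CoeffRegular (fun ω => c • X ω) :=
  hX.smul measurable_const (Cf := ‖c‖) fun _ => le_rfl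

/-- Negation. [folklore] -/
theorem neg (hX : CoeffRegular X) : CoeffRegular (fun ω => -X ω) := by
  simpa using hX.const_smul (-1)

omit [MeasurableSpace Ω] in
/-- The coefficient of a product, bilinearly expanded. [folklore] -/
theorem coordFn_mul (s : Finset ι) (x y : GrassmannAlgebra ℂ ι) :
    coordFn s (x * y) = ∑ t, ∑ t', coordFn t x * coordFn t' y *
      coordFn s (grassmannBasis ℂ ι t * grassmannBasis ℂ ι t') := by
  conv_lhs => rw [← sum_coordFn_smul x, ← sum_coordFn_smul y, Finset.sum_mul_sum]
  unfold coordFn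
  simp only [map_sum, Finsupp.coe_finsetSum, Finset.sum_apply, smul_mul_smul_comm, map_smul,
    Finsupp.smul_apply, smul_eq_mul, mul_assoc]

/-- **Products are regular.** [folklore] -/
theorem mul (hX : CoeffRegular X) (hY : CoeffRegular Y) : CoeffRegular (fun ω => X ω * Y ω) := fun s => by
  choose C hC using fun t => (hX t).2
  choose C' hC' using fun t => (hY t).2
  refine ⟨?_, ∑ t, ∑ t', C t * C' t' * ‖coordFn s (grassmannBasis ℂ ι t * grassmannBasis ℂ ι t')‖, fun ω => ?_⟩
  · have he : (fun ω => coordFn s (X ω * Y ω)) = fun ω => ∑ t, ∑ t', coordFn t (X ω) * coordFn t' (Y ω) *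
        coordFn s (grassmannBasis ℂ ι t * grassmannBasis ℂ ι t') := funext fun ω => coordFn_mul s _ _
    rw [he]
    exact Finset.measurable_sum _ fun t _ => Finset.measurable_sum _ fun t' _ =>
      (((hX t).1.mul (hY t').1).mul measurable_const)
  · rw [coordFn_mul s]
    refine (norm_sum_le _ _).trans (Finset.sum_le_sum fun t _ => (norm_sum_le _ _).trans
      (Finset.sum_le_sum fun t' _ => ?_))
    rw [norm_mul, norm_mul]
    have h0 : 0 ≤ C t := (norm_nonneg _).trans (hC t ω)
    exact mul_le_mul (mul_le_mul (hC t ω) (hC' t' ω) (norm_nonneg _) h0) le_rfl (norm_nonneg _)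
      (mul_nonneg h0 ((norm_nonneg _).trans (hC' t' ω)))

/-- List products are regular. [folklore] -/
theorem list_prod {K : Type*} (l : List K) {X : K → Ω → GrassmannAlgebra ℂ ι} (hX : ∀ k ∈ l, CoeffRegular (X k)) :
    CoeffRegular (fun ω => (l.map fun k => X k ω).prod) := by
  induction l with
  | nil => simpa using coeffRegular_const (Ω := Ω) (1 : GrassmannAlgebra ℂ ι)
  | cons a l ih =>
    have h := (hX a (List.mem_cons_self)).mul (ih fun k hk => hX k (List.mem_cons_of_mem a hk))
    simpa [List.map_cons, List.prod_cons] using h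

/-- Finite products (in a commutative situation one may use `Finset.prod`; here `Finset.prod` over the
commutative coefficientwise structure is not available, so we state powers). Powers are regular. [folklore] -/
theorem pow (hX : CoeffRegular X) (n : ℕ) : CoeffRegular (fun ω => X ω ^ n) := by
  induction n with
  | zero => simpa using coeffRegular_const (Ω := Ω) (1 : GrassmannAlgebra ℂ ι)
  | succ n ih => simpa [pow_succ] using ih.mul hX

/-- **Fixed linear maps preserve regularity** (into a possibly different Grassmann algebra). [folklore] -/
theorem linearMap {ι' : Type*} [LinearOrder ι'] [Fintype ι'] (hX : CoeffRegular X)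
    (T : GrassmannAlgebra ℂ ι →ₗ[ℂ] GrassmannAlgebra ℂ ι') : CoeffRegular (fun ω => T (X ω)) := fun s => by
  have hexp : ∀ ω, coordFn s (T (X ω)) = ∑ t, coordFn t (X ω) * coordFn s (T (grassmannBasis ℂ ι t)) := by
    intro ω
    conv_lhs => rw [← sum_coordFn_smul (X ω), map_sum]
    unfold coordFn
    simp only [map_sum, map_smul, Finsupp.coe_finsetSum, Finset.sum_apply, Finsupp.smul_apply, smul_eq_mul]
  choose C hC using fun t => (hX t).2
  refine ⟨?_, ∑ t, C t * ‖coordFn s (T (grassmannBasis ℂ ι t))‖, fun ω => ?_⟩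
  · simp only [hexp]
    exact Finset.measurable_sum _ fun t _ => (hX t).1.mul measurable_const
  · rw [hexp]
    refine (norm_sum_le _ _).trans (Finset.sum_le_sum fun t _ => ?_)
    rw [norm_mul]
    exact mul_le_mul (hC t ω) le_rfl (norm_nonneg _) ((norm_nonneg _).trans (hC t ω))

/-- Fixed algebra homomorphisms preserve regularity. [folklore] -/
theorem algHom {ι' : Type*} [LinearOrder ι'] [Fintype ι'] (hX : CoeffRegular X)
    (T : GrassmannAlgebra ℂ ι →ₐ[ℂ] GrassmannAlgebra ℂ ι') : CoeffRegular (fun ω => T (X ω)) :=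
  hX.linearMap T.toLinearMap

/-- **Antilinear reflections preserve regularity.** [folklore] -/
theorem reflection (hX : CoeffRegular X) (Θ : Reflection ι) : CoeffRegular (fun ω => Θ (X ω)) := fun s => by
  have hexp : ∀ ω, coordFn s (Θ (X ω)) = ∑ t, conj (coordFn t (X ω)) * coordFn s (Θ (grassmannBasis ℂ ι t)) := by
    intro ω
    conv_lhs => rw [← sum_coordFn_smul (X ω), Θ.map_sum]
    unfold coordFn
    simp only [Θ.map_smul, map_sum, map_smul, Finsupp.coe_finsetSum, Finset.sum_apply, Finsupp.smul_apply,
      smul_eq_mul]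
  choose C hC using fun t => (hX t).2
  refine ⟨?_, ∑ t, C t * ‖coordFn s (Θ (grassmannBasis ℂ ι t))‖, fun ω => ?_⟩
  · simp only [hexp]
    exact Finset.measurable_sum _ fun t _ =>
      (Complex.continuous_conj.measurable.comp (hX t).1).mul measurable_const
  · rw [hexp]
    refine (norm_sum_le _ _).trans (Finset.sum_le_sum fun t _ => ?_)
    rw [norm_mul, Complex.norm_conj]
    exact mul_le_mul (hC t ω) le_rfl (norm_nonneg _) ((norm_nonneg _).trans (hC t ω))

/-- **A fixed linear functional of a regular variable is a bounded measurable function.** [folklore] -/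
theorem measurable_apply (hX : CoeffRegular X) (lam : GrassmannAlgebra ℂ ι →ₗ[ℂ] ℂ) :
    Measurable fun ω => lam (X ω) := by
  have hexp : ∀ ω, lam (X ω) = ∑ t, coordFn t (X ω) * lam (grassmannBasis ℂ ι t) := by
    intro ω
    conv_lhs => rw [← sum_coordFn_smul (X ω), map_sum]
    simp only [map_smul, smul_eq_mul]
  simp only [hexp]
  exact Finset.measurable_sum _ fun t _ => (hX t).1.mul measurable_const

/-- The bound of a fixed linear functional of a regular variable. [folklore] -/
theorem exists_norm_apply_le (hX : CoeffRegular X) (lam : GrassmannAlgebra ℂ ι →ₗ[ℂ] ℂ) :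
    ∃ C : ℝ, ∀ ω, ‖lam (X ω)‖ ≤ C := by
  have hexp : ∀ ω, lam (X ω) = ∑ t, coordFn t (X ω) * lam (grassmannBasis ℂ ι t) := by
    intro ω
    conv_lhs => rw [← sum_coordFn_smul (X ω), map_sum]
    simp only [map_smul, smul_eq_mul]
  choose C hC using fun t => (hX t).2
  refine ⟨∑ t, C t * ‖lam (grassmannBasis ℂ ι t)‖, fun ω => ?_⟩
  rw [hexp]
  refine (norm_sum_le _ _).trans (Finset.sum_le_sum fun t _ => ?_)
  rw [norm_mul]
  exact mul_le_mul (hC t ω) le_rfl (norm_nonneg _) ((norm_nonneg _).trans (hC t ω))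

/-- **The exponential of a regular variable without constant term is regular**
(`exp x = Σ_{k ≤ |ι|} xᵏ/k!` uniformly, `pow_card_succ_eq_zero_of_coord_empty`). [folklore] -/
theorem grassmannExp (hX : CoeffRegular X) (h0 : ∀ ω, (grassmannBasis ℂ ι).coord ∅ (X ω) = 0) :
    CoeffRegular (fun ω => _root_.Literature.MathematicalPhysics.QuantumLattice.grassmannExp (X ω)) := by
  have hexp : ∀ ω, _root_.Literature.MathematicalPhysics.QuantumLattice.grassmannExp (X ω) =
      ∑ k ∈ Finset.range (Fintype.card ι + 1), ((k.factorial : ℚ)⁻¹ : ℚ) • X ω ^ k := fun ω =>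
    IsNilpotent.exp_eq_sum (pow_card_succ_eq_zero_of_coord_empty ℂ (h0 ω))
  simp only [hexp]
  refine CoeffRegular.sum _ fun k _ => ?_
  have h := (hX.pow k).const_smul (((k.factorial : ℚ)⁻¹ : ℚ) : ℂ)
  refine fun s => ?_
  obtain ⟨hm, C, hC⟩ := h s
  have hq : ∀ ω, ((k.factorial : ℚ)⁻¹ : ℚ) • X ω ^ k = ((((k.factorial : ℚ)⁻¹ : ℚ) : ℂ)) • X ω ^ k := fun ω => by
    rw [Rat.cast_smul_eq_qsmul]
  simp only [hq]
  exact ⟨hm, C, hC⟩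

end CoeffRegular

/-- Regularity from coefficient data given through ANY family of "coordinate functionals realised by
the Berezin pairing": if for every `s` there is `y_s` with `∫(a · y_s) = [θ_s] a` (this is
`exists_berezin_mul_eq_coord` of `QCDTimeReflection`), pairing-regularity implies coefficient
regularity.  Stated with the realising family as a hypothesis so that this file stays below the QCD
files. [folklore] -/
theorem coeffRegular_of_pairing {X : Ω → GrassmannAlgebra ℂ ι}
    (hy : ∀ s : Finset ι, ∃ y : GrassmannAlgebra ℂ ι, ∀ a, berezin ℂ ι (a * y) = (grassmannBasis ℂ ι).coord s a)
    (hm : ∀ y, Measurable fun ω => berezin ℂ ι (X ω * y))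
    (hb : ∀ y, ∃ C : ℝ, ∀ ω, ‖berezin ℂ ι (X ω * y)‖ ≤ C) : CoeffRegular X := fun s => by
  obtain ⟨y, hy⟩ := hy s
  have he : ∀ ω, coordFn s (X ω) = berezin ℂ ι (X ω * y) := fun ω => by rw [hy]; rfl
  simp only [he]
  exact ⟨hm y, hb y⟩

end GrassmannAlgebra

end

end Literature.MathematicalPhysics.QuantumLattice
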